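import Summits.Ventures.GridStability.Models.WSCC9LosslessLinearisation

/-!
# GridStability/Models/LossySymmetrizerSpectrum — the uniform-damping small-signal lane WITH TRANSFER CONDUCTANCES (lossy lines): a symmetrizer certificate replaces the symmetric pencil

Cell `gridfusion` (LADDER-GRIDFUSION, APEX LINE «inverter-dominated networks», rung G3 / row family «G3-ss»;
seat gridfusion-model-3 (g6)). Sequel of `Models/UniformDampingSpectrum.lean` (p496499) and
`Models/InverterNetworkLinearisation.lean` (p497389), whose CEILING was «lossy lines make `L(δ)`
non-symmetric». Lifted here for the uniform-damping-ratio class (classical network-reduced model with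
`D_i = d·M_i` and ANY transfer conductances; equivalently a frozen-voltage droop microgrid with a COMMON
power-filter time constant and LOSSY Kron-reduced lines — the resistive-line case of inverter microgrids):
* §0 ([folklore], any `n`) `eig_real_gt_of_symmetrizer`: `A` any real matrix, `S ≻ 0`, `wᵀA = 0`,
  `S A − ν₀ S + β w wᵀ ≻ 0` (so `S` SYMMETRIZES `A`) ⇒ every complex eigenpair `A x = μ x`, `x ≠ 0`, has
  `μ = 0` or `μ` REAL `> ν₀` (`μ wᵀx = wᵀAx = 0` kills the rank-one term; `x*(SA − ν₀S)x = (μ − ν₀) x*Sx`);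
  the lossless `pencil_eig_real_gt` is `S = diag(M)`, `w = M`. `ker_eq_const_of_symmetrizer`: same
  certificate (`ν₀ ≥ 0`, `Σ w_i ≠ 0`, zero row sums) ⇒ `ker A` = constants.
* §1 (`ClassicalSwing`, uniform damping ratio, ANY `G`, `B`) `eig_quadratic_of_symmetrizer`,
  `eig_re_lt_neg_of_symmetrizer` (`d > 2r`, `ν₀ > dr − r²` ⇒ `Re z < −r` off the synchronous mode),
  `eig_re_eq_of_symmetrizer` (`ν₀ ≥ d²/4` ⇒ `Re z = −d/2` EXACTLY), `PeJac_ker_const_of_symmetrizer`;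
  §2 exact data bridge `RecastData.AblockQ` / `Ablock_toModelRel_angleOf`; §3 droop reading
  `DroopMicrogrid.eig_re_lt_neg_of_commonFilter_lossy` (no `G = 0`, no `B = Bᵀ` hypothesis).
WHY A SYMMETRIZER EXISTS (informal): when the spectrum of the real matrix `M⁻¹L(δ*)` is real and simple,
the symmetric solutions of `S A = AᵀS` form an `n`-dimensional RATIONAL subspace with positive definite
points (project `Σ ℓ_iℓ_iᵀ`, left eigenvectors); `w` spans the rational left kernel. COST per instance: two
exact `n × n` PSD checks + one vector identity, 0 core-h. CEILING (memo §3): complex pencil eigenvalues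
(heavily resistive lines) admit no symmetrizer — then `z² + dz + (a + ib) = 0` is Hurwitz iff `d²a > b²`,
a region certificate for certnum's Lyapunov lane (RQ-013); heterogeneous damping: `InverterNetworkDamping`.
THREE COLUMNS. CERTIFIED (kernel, once instantiated): statements about the MATRIX `J(δ)` = Fréchet
derivative of the typed field; nothing about the nonlinear flow. MODELLED: classical model WITH transfer
conductances MV-2 + MV-λ [cite: SauerPai1998, §6.10]; droop reading MV-6N [cite: KunduEtAl2019, eqs.
(4a)–(4b), (5a)] [cite: SchifferEtAl2014, Remark 3.3]. VALIDATED: nothing. No parameter values. No sentence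
of this file says a converter, a microgrid or a grid is stable.
-/

noncomputable section

open Real Matrix Finset
open scoped ComplexOrder ComplexConjugate

namespace Summit.Ventures.GridStability.Models

/-! ## §0 Linear algebra: real spectrum from a symmetrizer certificate -/

section Symmetrizer

variable {ι : Type*} [Fintype ι] [DecidableEq ι]

/-- The Hermitian form of a real positive definite matrix is positive on nonzero COMPLEX vectors
(plumbing; the tree's `Literature.Geometry.Kaehler.ComplexTorus.posDef_map_ofRealHom` says the same via
`CFC.sqrt` — not imported into this model file). [folklore] -/
theorem dotProduct_map_ofReal_mulVec_pos {S : Matrix ι ι ℝ} (hS : S.PosDef) {x : ι → ℂ} (hx : x ≠ 0) :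
    0 < star x ⬝ᵥ (S.map ((↑) : ℝ → ℂ) *ᵥ x) := by
  have hsd : (S.map Complex.ofRealHom).PosSemidef := by
    open scoped MatrixOrder in
    obtain ⟨B, hB⟩ := CStarAlgebra.nonneg_iff_eq_star_mul_self.mp hS.posSemidef.nonneg
    rw [hB, Matrix.star_eq_conjTranspose, Matrix.map_mul,
      Matrix.conjTranspose_map _ (fun a => by simp)]
    exact Matrix.posSemidef_conjTranspose_mul_self _
  have hSC : (S.map Complex.ofRealHom).PosDef := by
    refine hsd.posDef_iff_det_ne_zero.mpr ?_
    rw [← RingHom.mapMatrix_apply, ← RingHom.map_det, Complex.ofRealHom_eq_coe,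
      Complex.ofReal_ne_zero]
    exact hS.det_pos.ne'
  exact hSC.dotProduct_mulVec_pos hx

omit [DecidableEq ι] in
/-- Entry formula: `((S·A) x)_i = Σ_k S_ik (A x)_k` over `ℂ` for real `S`, `A`. [folklore] -/
theorem map_ofReal_mul_mulVec_apply (S A : Matrix ι ι ℝ) (x : ι → ℂ) (i : ι) :
    ((S * A).map ((↑) : ℝ → ℂ) *ᵥ x) i = ∑ k, (S i k : ℂ) * (A.map ((↑) : ℝ → ℂ) *ᵥ x) k := by
  simp only [map_ofReal_mulVec_apply, Matrix.mul_apply]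
  push_cast
  simp only [Finset.sum_mul, Finset.mul_sum]
  rw [Finset.sum_comm]
  refine Finset.sum_congr rfl fun k _ => Finset.sum_congr rfl fun j _ => ?_
  ring

/-- **Real spectrum beyond a threshold from a SYMMETRIZER certificate (any `n`, solver-free).** `A` real,
`S ≻ 0` real, `wᵀ A = 0`, and `S A − ν₀·S + β·(w wᵀ) ≻ 0` (in particular `S` symmetrizes `A`) ⇒ every
complex solution of `A x = μ x`, `x ≠ 0`, has `μ = 0` or `μ` REAL with `μ > ν₀` (the lossless
`pencil_eig_real_gt` is `S = diag(M)`, `w = M`, `A = M⁻¹L`). [folklore] -/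
theorem eig_real_gt_of_symmetrizer {A S : Matrix ι ι ℝ} {w : ι → ℝ} (hS : S.PosDef)
    (hw : Matrix.vecMul w A = 0) {ν₀ β : ℝ}
    (hC : (S * A - ν₀ • S + β • Matrix.vecMulVec w w).PosDef)
    {μ : ℂ} {x : ι → ℂ} (hx : x ≠ 0) (hAx : A.map ((↑) : ℝ → ℂ) *ᵥ x = μ • x) :
    μ = 0 ∨ (μ.im = 0 ∧ ν₀ < μ.re) := by
  by_cases hμ0 : μ = 0
  · exact Or.inl hμ0
  right
  have hwA : ∀ j, ∑ i, w i * A i j = 0 := fun j => by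
    have := congr_fun hw j
    simpa [Matrix.vecMul, dotProduct] using this
  have hAxi : ∀ i, (A.map ((↑) : ℝ → ℂ) *ᵥ x) i = μ * x i := fun i => by
    simpa using congr_fun hAx i
  have hsum : ∑ i, (w i : ℂ) * x i = 0 := by
    have h1 : ∑ i, (w i : ℂ) * (A.map ((↑) : ℝ → ℂ) *ᵥ x) i = 0 := by
      simp_rw [map_ofReal_mulVec_apply, Finset.mul_sum]
      rw [Finset.sum_comm]
      refine Finset.sum_eq_zero fun j _ => ?_
      have : ∑ i, (w i : ℂ) * ((A i j : ℂ) * x j) = (∑ i, ((w i * A i j : ℝ) : ℂ)) * x j := by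
        rw [Finset.sum_mul]
        refine Finset.sum_congr rfl fun i _ => ?_
        push_cast
        ring
      rw [this]
      have h0 : (∑ i, ((w i * A i j : ℝ) : ℂ)) = 0 := by exact_mod_cast hwA j
      rw [h0, zero_mul]
    simp_rw [hAxi] at h1
    have h2 : μ * ∑ i, (w i : ℂ) * x i = 0 := by
      rw [Finset.mul_sum, ← h1]
      refine Finset.sum_congr rfl fun i _ => ?_
      ring
    rcases mul_eq_zero.1 h2 with h | h
    · exact absurd h hμ0
    · exact h
  set C : Matrix ι ι ℝ := S * A - ν₀ • S + β • Matrix.vecMulVec w w with hCdef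
  have hCx : ∀ i, (C.map ((↑) : ℝ → ℂ) *ᵥ x) i = (μ - ν₀) * (S.map ((↑) : ℝ → ℂ) *ᵥ x) i := by
    intro i
    have hSA : ((S * A).map ((↑) : ℝ → ℂ) *ᵥ x) i = μ * (S.map ((↑) : ℝ → ℂ) *ᵥ x) i := by
      rw [map_ofReal_mul_mulVec_apply, map_ofReal_mulVec_apply, Finset.mul_sum]
      refine Finset.sum_congr rfl fun k _ => ?_
      rw [hAxi]
      ring
    have hW : ((Matrix.vecMulVec w w).map ((↑) : ℝ → ℂ) *ᵥ x) i = 0 := by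
      rw [map_ofReal_mulVec_apply]
      have : ∑ j, ((Matrix.vecMulVec w w i j : ℝ) : ℂ) * x j = (w i : ℂ) * ∑ j, (w j : ℂ) * x j := by
        rw [Finset.mul_sum]
        refine Finset.sum_congr rfl fun j _ => ?_
        simp only [Matrix.vecMulVec_apply]
        push_cast
        ring
      rw [this, hsum, mul_zero]
    have hsplit : C.map ((↑) : ℝ → ℂ) = (S * A).map ((↑) : ℝ → ℂ) - (ν₀ : ℂ) • S.map ((↑) : ℝ → ℂ)
        + (β : ℂ) • (Matrix.vecMulVec w w).map ((↑) : ℝ → ℂ) := by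
      ext a b
      simp [hCdef, Matrix.add_apply, Matrix.sub_apply, Matrix.smul_apply]
    rw [hsplit, Matrix.add_mulVec, Matrix.sub_mulVec, Matrix.smul_mulVec, Matrix.smul_mulVec]
    simp only [Pi.add_apply, Pi.sub_apply, Pi.smul_apply, smul_eq_mul, hSA, hW, mul_zero, add_zero]
    ring
  have hq : 0 < star x ⬝ᵥ (C.map ((↑) : ℝ → ℂ) *ᵥ x) := dotProduct_map_ofReal_mulVec_pos hC hx
  have hp : 0 < star x ⬝ᵥ (S.map ((↑) : ℝ → ℂ) *ᵥ x) := dotProduct_map_ofReal_mulVec_pos hS hx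
  have hqeq : star x ⬝ᵥ (C.map ((↑) : ℝ → ℂ) *ᵥ x) = (μ - ν₀) * (star x ⬝ᵥ (S.map ((↑) : ℝ → ℂ) *ᵥ x)) := by
    simp only [dotProduct, Pi.star_apply, hCx, Finset.mul_sum]
    refine Finset.sum_congr rfl fun i _ => ?_
    ring
  obtain ⟨hpre, hpim⟩ := Complex.pos_iff.1 hp
  set p : ℝ := (star x ⬝ᵥ (S.map ((↑) : ℝ → ℂ) *ᵥ x)).re with hpdef
  have hpC : star x ⬝ᵥ (S.map ((↑) : ℝ → ℂ) *ᵥ x) = (p : ℂ) := Complex.ext (by simp [hpdef]) (by simp [← hpim])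
  rw [hqeq, hpC] at hq
  have hdiv : μ - ν₀ = (μ - ν₀) * (p : ℂ) * ((p⁻¹ : ℝ) : ℂ) := by
    have hp0 : (p : ℂ) ≠ 0 := by exact_mod_cast hpre.ne'
    push_cast
    field_simp
  obtain ⟨hre, him⟩ := Complex.pos_iff.1 hq
  have key_im : (μ - ν₀).im = 0 := by
    rw [hdiv, Complex.im_mul_ofReal, ← him, zero_mul]
  have key_re : 0 < (μ - ν₀).re := by
    rw [hdiv, Complex.re_mul_ofReal]
    exact mul_pos hre (inv_pos.2 hpre)
  constructor
  · simpa using key_im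
  · have : (μ - (ν₀ : ℂ)).re = μ.re - ν₀ := by simp
    linarith [this ▸ key_re]

/-- **The kernel is the constants (same certificate)**: `A` real with zero ROW sums, `S ≻ 0`, `wᵀA = 0`,
`Σ w_i ≠ 0`, `ν₀ ≥ 0`, `S A − ν₀·S + β·(w wᵀ) ≻ 0` ⇒ every complex `x` with `A x = 0` is CONSTANT
(`y := x − (wᵀx/wᵀ1)·1` has `A y = 0`, `wᵀy = 0`, `y*C y = −ν₀ y*Sy ≤ 0`). [folklore] -/
theorem ker_eq_const_of_symmetrizer {A S : Matrix ι ι ℝ} {w : ι → ℝ}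
    (hrow : ∀ i, ∑ j, A i j = 0) (hS : S.PosDef) (hw : Matrix.vecMul w A = 0)
    (hw1 : ∑ i, w i ≠ 0) {ν₀ β : ℝ} (hν₀ : 0 ≤ ν₀)
    (hC : (S * A - ν₀ • S + β • Matrix.vecMulVec w w).PosDef)
    {x : ι → ℂ} (hAx : A.map ((↑) : ℝ → ℂ) *ᵥ x = 0) : ∃ c : ℂ, x = fun _ => c := by
  classical
  have hwA : ∀ j, ∑ i, w i * A i j = 0 := fun j => by
    have := congr_fun hw j
    simpa [Matrix.vecMul, dotProduct] using this
  set c : ℂ := (∑ i, (w i : ℂ) * x i) / ((∑ i, w i : ℝ) : ℂ) with hcdef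
  refine ⟨c, ?_⟩
  set y : ι → ℂ := fun i => x i - c with hydef
  have hAy : A.map ((↑) : ℝ → ℂ) *ᵥ y = 0 := by
    have : y = x - fun _ => c := by funext i; simp [hydef]
    rw [this, Matrix.mulVec_sub, hAx, mulVec_const_eq_zero_of_rowsum hrow c, sub_zero]
  have hsum : ∑ i, (w i : ℂ) * y i = 0 := by
    have hS0 : ((∑ i, w i : ℝ) : ℂ) ≠ 0 := by exact_mod_cast hw1
    simp only [hydef, mul_sub, Finset.sum_sub_distrib, ← Finset.sum_mul]
    rw [hcdef]
    have hcast : (∑ i, (w i : ℂ)) = ((∑ i, w i : ℝ) : ℂ) := by push_cast; rfl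
    rw [hcast, mul_div_cancel₀ _ hS0, sub_self]
  set C : Matrix ι ι ℝ := S * A - ν₀ • S + β • Matrix.vecMulVec w w with hCdef
  have hCy : ∀ i, (C.map ((↑) : ℝ → ℂ) *ᵥ y) i = -(ν₀ : ℂ) * (S.map ((↑) : ℝ → ℂ) *ᵥ y) i := by
    intro i
    have hSA : ((S * A).map ((↑) : ℝ → ℂ) *ᵥ y) i = 0 := by
      rw [map_ofReal_mul_mulVec_apply]
      refine Finset.sum_eq_zero fun k _ => ?_
      rw [hAy]
      simp
    have hW : ((Matrix.vecMulVec w w).map ((↑) : ℝ → ℂ) *ᵥ y) i = 0 := by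
      rw [map_ofReal_mulVec_apply]
      have : ∑ j, ((Matrix.vecMulVec w w i j : ℝ) : ℂ) * y j = (w i : ℂ) * ∑ j, (w j : ℂ) * y j := by
        rw [Finset.mul_sum]
        refine Finset.sum_congr rfl fun j _ => ?_
        simp only [Matrix.vecMulVec_apply]
        push_cast
        ring
      rw [this, hsum, mul_zero]
    have hsplit : C.map ((↑) : ℝ → ℂ) = (S * A).map ((↑) : ℝ → ℂ) - (ν₀ : ℂ) • S.map ((↑) : ℝ → ℂ)
        + (β : ℂ) • (Matrix.vecMulVec w w).map ((↑) : ℝ → ℂ) := by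
      ext a b
      simp [hCdef, Matrix.add_apply, Matrix.sub_apply, Matrix.smul_apply]
    rw [hsplit, Matrix.add_mulVec, Matrix.sub_mulVec, Matrix.smul_mulVec, Matrix.smul_mulVec]
    simp only [Pi.add_apply, Pi.sub_apply, Pi.smul_apply, smul_eq_mul, hSA, hW, mul_zero, add_zero]
    ring
  by_contra hx
  have hy : y ≠ 0 := by
    intro hy0
    apply hx
    funext i
    have := congr_fun hy0 i
    simp only [hydef, Pi.zero_apply, sub_eq_zero] at this
    exact this
  have hq : 0 < star y ⬝ᵥ (C.map ((↑) : ℝ → ℂ) *ᵥ y) := dotProduct_map_ofReal_mulVec_pos hC hy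
  have hp : 0 < star y ⬝ᵥ (S.map ((↑) : ℝ → ℂ) *ᵥ y) := dotProduct_map_ofReal_mulVec_pos hS hy
  have hqeq : star y ⬝ᵥ (C.map ((↑) : ℝ → ℂ) *ᵥ y)
      = -(ν₀ : ℂ) * (star y ⬝ᵥ (S.map ((↑) : ℝ → ℂ) *ᵥ y)) := by
    simp only [dotProduct, Pi.star_apply, hCy, Finset.mul_sum]
    refine Finset.sum_congr rfl fun i _ => ?_
    ring
  obtain ⟨hpre, hpim⟩ := Complex.pos_iff.1 hp
  set p : ℝ := (star y ⬝ᵥ (S.map ((↑) : ℝ → ℂ) *ᵥ y)).re with hpdef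
  have hpC : star y ⬝ᵥ (S.map ((↑) : ℝ → ℂ) *ᵥ y) = (p : ℂ) := Complex.ext (by simp [hpdef]) (by simp [← hpim])
  rw [hqeq, hpC] at hq
  obtain ⟨hre, -⟩ := Complex.pos_iff.1 hq
  have : (-(ν₀ : ℂ) * (p : ℂ)).re = -(ν₀ * p) := by
    rw [← Complex.ofReal_neg, ← Complex.ofReal_mul]
    simp
  rw [this] at hre
  nlinarith [mul_nonneg hν₀ hpre.le]

end Symmetrizer

/-! ## §1 The classical network-reduced model with transfer conductances, uniform damping ratio -/

namespace ClassicalSwing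

variable {n : ℕ} (p : ClassicalSwing n)

/-- `M⁻¹L(δ) x = 0 ⟺ L(δ) x = 0` (over `ℂ`, `M_i ≠ 0`). [folklore] -/
theorem Ablock_map_mulVec_eq_zero_iff (hM : ∀ i, p.M i ≠ 0) (δ : Fin n → ℝ) (x : Fin n → ℂ) :
    (p.Ablock δ).map ((↑) : ℝ → ℂ) *ᵥ x = 0 ↔ (p.PeJac δ).map ((↑) : ℝ → ℂ) *ᵥ x = 0 := by
  constructor
  · intro h
    funext i
    have hi := congr_fun h i
    rw [Ablock_map_mulVec] at hi
    simp only [Pi.zero_apply, mul_eq_zero, Complex.ofReal_eq_zero, inv_eq_zero] at hi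
    rcases hi with h0 | h0
    · exact absurd h0 (hM i)
    · exact h0
  · intro h
    funext i
    rw [Ablock_map_mulVec, h]
    simp

/-- The rows of `M⁻¹L(δ)` sum to zero (`P_e` depends on angle differences only). [folklore] -/
theorem Ablock_rowsum (δ : Fin n → ℝ) (i : Fin n) : ∑ j, p.Ablock δ i j = 0 := by
  simp only [Ablock, ← Finset.mul_sum]
  have h : ∑ j, p.PeJac δ i j = 0 := by
    rw [← Finset.add_sum_erase _ _ (Finset.mem_univ i)]
    have h1 : p.PeJac δ i i = ∑ k ∈ univ.erase i, p.syncCoef δ i k := by simp [PeJac]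
    have h2 : ∑ j ∈ univ.erase i, p.PeJac δ i j = ∑ j ∈ univ.erase i, -p.syncCoef δ i j := by
      refine Finset.sum_congr rfl fun j hj => ?_
      simp only [PeJac, if_neg (Finset.ne_of_mem_erase hj)]
    rw [h1, h2, ← Finset.sum_add_distrib]
    simp
  rw [h, mul_zero]

/-- **The decoupled mode equation, LOSSY network**: uniform damping ratio, ANY `G`, `B`, a symmetrizer
certificate for `A = M⁻¹L(δ)` ⇒ every eigenpair `(z, [x; y])` of `J(δ)` is SYNCHRONOUS (`L(δ) x = 0`) or has
`z² + d z + μ = 0` for a REAL `μ > ν₀`. [folklore] -/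
theorem eig_quadratic_of_symmetrizer (hM : ∀ i, 0 < p.M i) {d : ℝ} (hD : ∀ i, p.D i = d * p.M i)
    (δ : Fin n → ℝ) {S : Matrix (Fin n) (Fin n) ℝ} {w : Fin n → ℝ} {ν₀ β : ℝ} (hS : S.PosDef)
    (hw : Matrix.vecMul w (p.Ablock δ) = 0)
    (hC : (S * p.Ablock δ - ν₀ • S + β • Matrix.vecMulVec w w).PosDef)
    {z : ℂ} {v : Fin n ⊕ Fin n → ℂ} (hv : v ≠ 0)
    (hJ : (p.jacMatrix δ).map ((↑) : ℝ → ℂ) *ᵥ v = z • v) :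
    (p.PeJac δ).map ((↑) : ℝ → ℂ) *ᵥ (v ∘ Sum.inl) = 0 ∨
      ∃ μ : ℝ, ν₀ < μ ∧ z ^ 2 + (d : ℂ) * z + (μ : ℂ) = 0 := by
  have hM' : ∀ i, p.M i ≠ 0 := fun i => (hM i).ne'
  rw [p.jacMatrix_eq_secondOrderJac hD hM' δ, secondOrderJac_map_ofReal] at hJ
  have hx := secondOrderJac_eig_fst_ne_zero hJ hv
  have hA := ((secondOrderJac_eig_iff _ _ z v).1 hJ).2
  set μ : ℂ := -(z ^ 2 + (d : ℂ) * z) with hμdef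
  have hAμ : (p.Ablock δ).map ((↑) : ℝ → ℂ) *ᵥ (v ∘ Sum.inl) = μ • (v ∘ Sum.inl) := by
    rw [hA, hμdef, neg_smul]
  rcases eig_real_gt_of_symmetrizer hS hw hC hx hAμ with h0 | ⟨him, hre⟩
  · left
    rw [← p.Ablock_map_mulVec_eq_zero_iff hM', hAμ, h0, zero_smul]
  · right
    refine ⟨μ.re, hre, ?_⟩
    have hμre : (μ.re : ℂ) = μ := Complex.ext (by simp) (by simp [him])
    rw [hμre, hμdef]
    ring

/-- **Certified small-signal decay rate, classical model WITH transfer conductances, uniform damping ratio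
`D_i = d·M_i` (`M_i > 0`), any `δ`.** `S ≻ 0`, `wᵀ(M⁻¹L(δ)) = 0`, `S·M⁻¹L(δ) − ν₀·S + β·w wᵀ ≻ 0`, `d > 2r`,
`ν₀ − d r + r² > 0` ⇒ every complex eigenpair of `J(δ)` is synchronous (`L(δ) x = 0`) or has `Re z < −r`.
CERTIFIED: about the matrix `J(δ)`; MODELLED: MV-2 (lossy Kron reduction KEPT) + MV-λ
[cite: SauerPai1998, §6.10]; [cite: HairerNorsettWanner1993, §I.13 Theorem 13.4]. No stability sentence. -/
theorem eig_re_lt_neg_of_symmetrizer (hM : ∀ i, 0 < p.M i) {d : ℝ} (hD : ∀ i, p.D i = d * p.M i)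
    (δ : Fin n → ℝ) {S : Matrix (Fin n) (Fin n) ℝ} {w : Fin n → ℝ} {ν₀ β r : ℝ} (hS : S.PosDef)
    (hw : Matrix.vecMul w (p.Ablock δ) = 0)
    (hC : (S * p.Ablock δ - ν₀ • S + β • Matrix.vecMulVec w w).PosDef)
    (hd : 0 < d - 2 * r) (hν : 0 < ν₀ - d * r + r ^ 2)
    {z : ℂ} {v : Fin n ⊕ Fin n → ℂ} (hv : v ≠ 0)
    (hJ : (p.jacMatrix δ).map ((↑) : ℝ → ℂ) *ᵥ v = z • v) :
    (p.PeJac δ).map ((↑) : ℝ → ℂ) *ᵥ (v ∘ Sum.inl) = 0 ∨ z.re < -r := by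
  rcases p.eig_quadratic_of_symmetrizer hM hD δ hS hw hC hv hJ with h0 | ⟨μ, hμ, hq⟩
  · exact Or.inl h0
  · exact Or.inr ((quadratic_re_lt_neg_iff d μ r).2 ⟨hd, by linarith⟩ z hq)

/-- **Underdamped regime, lossy network: every non-synchronous mode decays at rate EXACTLY `d/2`** when the
certificate level satisfies `ν₀ ≥ d²/4`. CERTIFIED (matrix statement); MODELLED: MV-2 + MV-λ. No stability
sentence. [folklore] -/
theorem eig_re_eq_of_symmetrizer (hM : ∀ i, 0 < p.M i) {d : ℝ} (hD : ∀ i, p.D i = d * p.M i)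
    (δ : Fin n → ℝ) {S : Matrix (Fin n) (Fin n) ℝ} {w : Fin n → ℝ} {ν₀ β : ℝ} (hS : S.PosDef)
    (hw : Matrix.vecMul w (p.Ablock δ) = 0)
    (hC : (S * p.Ablock δ - ν₀ • S + β • Matrix.vecMulVec w w).PosDef)
    (hν : d ^ 2 ≤ 4 * ν₀) {z : ℂ} {v : Fin n ⊕ Fin n → ℂ} (hv : v ≠ 0)
    (hJ : (p.jacMatrix δ).map ((↑) : ℝ → ℂ) *ᵥ v = z • v) :
    (p.PeJac δ).map ((↑) : ℝ → ℂ) *ᵥ (v ∘ Sum.inl) = 0 ∨ z.re = -(d / 2) := by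
  rcases p.eig_quadratic_of_symmetrizer hM hD δ hS hw hC hv hJ with h0 | ⟨μ, hμ, hq⟩
  · exact Or.inl h0
  · exact Or.inr (quadratic_re_eq_of_discr_neg (by linarith) hq)

/-- **The synchronous mode is the uniform angle shift (lossy network, same certificate)**: with `ν₀ ≥ 0` and
`Σ w_i ≠ 0`, `L(δ) x = 0` forces `x` constant. [folklore] -/
theorem PeJac_ker_const_of_symmetrizer (hM : ∀ i, p.M i ≠ 0) (δ : Fin n → ℝ)
    {S : Matrix (Fin n) (Fin n) ℝ} {w : Fin n → ℝ} {ν₀ β : ℝ} (hS : S.PosDef)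
    (hw : Matrix.vecMul w (p.Ablock δ) = 0) (hw1 : ∑ i, w i ≠ 0) (hν₀ : 0 ≤ ν₀)
    (hC : (S * p.Ablock δ - ν₀ • S + β • Matrix.vecMulVec w w).PosDef)
    {x : Fin n → ℂ} (hL : (p.PeJac δ).map ((↑) : ℝ → ℂ) *ᵥ x = 0) : ∃ c : ℂ, x = fun _ => c :=
  ker_eq_const_of_symmetrizer (p.Ablock_rowsum δ) hS hw hw1 hν₀ hC
    ((p.Ablock_map_mulVec_eq_zero_iff hM δ x).2 hL)

end ClassicalSwing

/-! ## §2 Exact data bridge: `M⁻¹L(δ*)` of `toModelRel λ a′` is a rational matrix -/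

namespace RecastData

variable {n : ℕ} (d : RecastData n)

/-- The exact rational matrix `A(δ*) = M⁻¹L(δ*)`: `A_ij = L_ij / M_i` (`PeJacQ`, p498081). [folklore] -/
def AblockQ : Matrix (Fin (n + 1)) (Fin (n + 1)) ℚ := fun i j => d.PeJacQ i j / d.M i

/-- **Bridge**: the real Jacobian block `M⁻¹L(δ*)` of `toModelRel λ a′` at `angleOf` IS `AblockQ` cast to `ℝ`.
[folklore] -/
theorem Ablock_toModelRel_angleOf (hcirc : ∀ i, d.s i ^ 2 + d.c i ^ 2 = 1) (lam : ℚ) (a : ℝ) :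
    (d.toModelRel lam a).Ablock d.angleOf = d.AblockQ.map ((↑) : ℚ → ℝ) := by
  ext i j
  simp only [ClassicalSwing.Ablock, d.PeJac_toModelRel_angleOf hcirc, Matrix.map_apply, AblockQ,
    toModelRel_M]
  push_cast
  ring

end RecastData

/-! ## §3 Reading on the droop-inverter microgrid with a common power-filter time constant and LOSSY lines -/

namespace DroopMicrogrid

variable {n : ℕ} (mg : DroopMicrogrid n)

/-- **Certified small-signal decay rate for an `n`-unit droop microgrid with a COMMON power-filter time
constant `τ` and LOSSY Kron-reduced lines (frozen voltages `V`)**: uniform damping ratio `d = 1/τ`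
(`toClassicalSwing_uniformDamping`) + a symmetrizer certificate for `M⁻¹L(δ)` + `1/τ > 2r`,
`ν₀ − r/τ + r² > 0` ⇒ `Re z < −r` off the synchronous mode; no hypothesis on `G` or on the symmetry of `B`.
CERTIFIED: about the matrix `J(δ)` of the MODEL; MODELLED: MV-6N with lossy lines
[cite: KunduEtAl2019, eqs. (4a)–(4b), (5a)] [cite: SchifferEtAl2014, Remark 3.3]. No stability sentence. -/
theorem eig_re_lt_neg_of_commonFilter_lossy (hk : ∀ i, 0 < mg.kP i) {τ : ℝ} (hτ0 : 0 < τ)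
    (hτ : ∀ i, mg.τP i = τ) (V δ : Fin n → ℝ) {S : Matrix (Fin n) (Fin n) ℝ} {w : Fin n → ℝ}
    {ν₀ β r : ℝ} (hS : S.PosDef) (hw : Matrix.vecMul w ((mg.toClassicalSwing V).Ablock δ) = 0)
    (hC : (S * (mg.toClassicalSwing V).Ablock δ - ν₀ • S + β • Matrix.vecMulVec w w).PosDef)
    (hd : 0 < 1 / τ - 2 * r) (hν : 0 < ν₀ - 1 / τ * r + r ^ 2)
    {z : ℂ} {v : Fin n ⊕ Fin n → ℂ} (hv : v ≠ 0)
    (hJ : ((mg.toClassicalSwing V).jacMatrix δ).map ((↑) : ℝ → ℂ) *ᵥ v = z • v) :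
    ((mg.toClassicalSwing V).PeJac δ).map ((↑) : ℝ → ℂ) *ᵥ (v ∘ Sum.inl) = 0 ∨ z.re < -r := by
  have hk' : ∀ i, mg.kP i ≠ 0 := fun i => (hk i).ne'
  have hM : ∀ i, 0 < (mg.toClassicalSwing V).M i := fun i => by
    simp only [toClassicalSwing, hτ i]
    exact div_pos hτ0 (hk i)
  exact (mg.toClassicalSwing V).eig_re_lt_neg_of_symmetrizer hM
    (mg.toClassicalSwing_uniformDamping hk' hτ0.ne' hτ V) δ hS hw hC hd hν hv hJ

end DroopMicrogrid

end Summit.Ventures.GridStability.Models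

end
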